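import Literature.Probability.NegativeDependence.ExchangeableNegativeAssociation
import Literature.Probability.NegativeDependence.AlmostExchangeableSequences
import Literature.Probability.NegativeDependence.TruncationStochasticDomination
import HarnessLib

/-!
# Exchangeable measures with ULC rank sequence are CNA+ (Pemantle, Thm. 2.7; Borcea–Brändén–Liggett, Thm. 3.7)

R. Pemantle, *Towards a theory of negative dependence* [Pemantle2000], §2.4 Thm. 2.7 (verbatim): "Suppose that `{X_j}`
are exchangeable. Then the six conditions CNA+, JNRD+, h-NLC+, CNA, JNRD and h-NLC (see Figure 1) are equivalent
to Ultra-Log-Concavity of the rank sequence `{a_k}`." Lemma 2.8 (verbatim): "Let `μ` be an exchangeable measure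
with ULC rank sequence. Suppose the measure `μ'` is obtained from `μ` by imposing an external field at
coordinates `1,…,k` […] and then projecting onto coordinates `r+1,…,n` for some `r ≥ k`. Then `μ'` is exchangeable
with ULC rank sequence." And (proof of Thm. 2.7, p. 11): "any sequence of external fields and projections may be
written as an external field that affects only those indices not appearing in the final measure, followed by a
single projection, followed by an external field".

J. Borcea, P. Brändén, T. M. Liggett [BorceaBrandenLiggett2007], §3 **Theorem 3.7 ([P])**: for
`f = Σ_k a_k e_k(z_1,…,z_n)`, `a_k ≥ 0`: ULC rank sequence ⟺ "either (and then all) of … NLC, h-NLC,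
Rayleigh/h-NLC+, CNA, CNA+"; §6 **Corollary 6.5** (CNA+ for almost exchangeable measures; proof: the weighted
symmetrization `f_k = c_k^{-1} Σ F(S) Π w_i^{X_i(S)}`, `c_k = Σ Π w_i^{X_i(S)}` over `|S| = k`, with "(a) `f_k ≤ f_{k+1}`
[…] and (b) `{d_k}` is an LC sequence […] since `d_k` is just the `k`-th elementary symmetric function on
`{w_{m+1},…,w_n}`").

## What is proved, and how

**`isCNAPlus_card`**: an exchangeable weight `S ↦ q_{|S|}` with `PF₂` profile (= ULC rank sequence without
internal zeros, Pemantle's convention) is CNA+ (`IsCNAPlus`, BBL Def. 2.7), hence **`BorceaBrandenLiggett_thm_3_7`**: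
for nonnegative exchangeable weights, Rayleigh ⟺ CNA+ (and, with the tree, ⟺ NLC ⟺ h-NLC ⟺ ULC rank sequence,
each implying CNA). Road (BBL Cor. 6.5 in the purely exchangeable case, organised as in Pemantle's proof):
* §1 a projection of an external field of `S ↦ q_{|S|}` is an external field of a (conditioned) exchangeable
  weight with profile `q'_k = Σ_j e_j(a) q_{k+j}` (`projectOn_extField_card_eq`), and `q'` is again `PF₂`
  (`isLogConcaveSeq_corr`: reversal + the tree's convolution theorem — Pemantle's Lemma 2.8 with weights);
* §2 the weighted symmetrized averages `f_i = c_i^{-1} Σ_{|A|=i} w^A F(A)` increase in `i` (BBL Cor. 6.5 (a)),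
  obtained here from the tree's Theorem 4.19 (`μ_{k-1} ≼ μ_k` for the strongly Rayleigh product weight `w^A`);
* §3 **`isNegAssoc_pin_extField_card`**: `pin I O ((S ↦ q_{|S|})^w)` is NA — the `RR₂` rearrangement of
  `ExchangeableNegativeAssociation.lean` with the kernel `p_{ij} = c_i d_j q_{c+i+j}`;
* §4 CNA+ and Theorem 3.7.

## References

* [Pemantle2000] R. Pemantle, Towards a theory of negative dependence, J. Math. Phys. 41 (2000) — §2.4 Thm. 2.7,
  Lemma 2.8, proof of Thm. 2.7.
* [BorceaBrandenLiggett2007] J. Borcea, P. Brändén, T. M. Liggett, J. Amer. Math. Soc. 22 (2009); arXiv:0707.2340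
  — §3 Thm. 3.7, §6 Cor. 6.5 (weighted symmetrization), §4.3.2 Thm. 4.19, §2.1 Def. 2.7.
* [Karlin1968] S. Karlin, Total positivity — Ch. 8 §1.
-/

noncomputable section

open Finset
open Literature.Combinatorics.Sahi2008
open Literature.Combinatorics.StablePolynomials
open Literature.Probability.Distributions

universe u

namespace Literature.Probability.NegativeDependence

/-! ## §1 Projections of external fields of exchangeable weights (Pemantle's Lemma 2.8, weighted) -/

section Projection

variable {σ : Type u} [Fintype σ] [DecidableEq σ]

omit [Fintype σ] in
/-- External fields and conditionings commute. [cite: Pemantle2000, §2.2 (closure operations);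
BorceaBrandenLiggett2007, §2.1] -/
theorem pin_extField (I O : Finset σ) (a : σ → ℝ) (μ : Finset σ → ℝ) :
    pin I O (extField a μ) = extField a (pin I O μ) := by
  funext S
  rw [pin_apply, extField_apply, extField_apply, pin_apply]
  split_ifs <;> simp

/-- An external field with zeros is the same field after conditioning its zero set out.
[cite: Pemantle2000, §2.2 (closure operations)] -/
theorem extField_eq_pin_zeroSet (a : σ → ℝ) (μ : Finset σ → ℝ) :
    extField a μ = pin ∅ (Finset.univ.filter fun e => a e = 0) (extField a μ) := by
  funext S
  rw [pin_apply]
  split_ifs with h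
  · rfl
  · rw [not_and_or] at h
    rcases h with h | h
    · exact absurd (Finset.empty_subset S) h
    · rw [Finset.not_disjoint_iff] at h
      obtain ⟨e, he, heS⟩ := h
      rw [extField_apply]
      exact mul_eq_zero_of_right _ (Finset.prod_eq_zero heS (Finset.mem_filter.1 he).2)

/-- **Projection of an external field of an exchangeable weight**: onto `2^S`,
`Σ_{U ∩ S = T} q_{|U|} a^U = a^T q'_{|T|}` with `q'_k = Σ_{W ⊆ Sᶜ} q_{k+|W|} a^W`. [cite: Pemantle2000, §2.4
Lemma 2.8 (proof: `q'_j = C (q_j + λ q_{j+1})` for one coordinate); BorceaBrandenLiggett2007, §6 proof of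
Prop. 6.3 (the projected coefficients)] -/
theorem projectOn_extField_card_eq (q : ℕ → ℝ) (a : σ → ℝ) (S : Finset σ) :
    projectOn S (extField a fun T : Finset σ => q T.card) =
      extField a (pin ∅ Sᶜ fun T : Finset σ => ∑ W ∈ Sᶜ.powerset, q (T.card + W.card) * ∏ e ∈ W, a e) := by
  funext T
  by_cases hT : T ⊆ S
  · rw [projectOn_apply, sum_ite_inter_eq S T hT, extField_apply, pin_apply,
      if_pos ⟨Finset.empty_subset _, Finset.disjoint_left.2 fun x hx hxT => (Finset.mem_compl.1 hx) (hT hxT)⟩,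
      Finset.sum_mul]
    refine Finset.sum_congr rfl fun W hW => ?_
    rw [Finset.mem_powerset] at hW
    have hdisj : Disjoint T W := Finset.disjoint_left.2 fun x hxT hxW => (Finset.mem_compl.1 (hW hxW)) (hT hxT)
    rw [extField_apply, Finset.card_union_of_disjoint hdisj, Finset.prod_union hdisj]
    ring
  · rw [projectOn_eq_zero_of_not_subset _ hT, extField_apply, pin_apply, if_neg, zero_mul]
    rintro ⟨-, h⟩
    exact hT fun x hx => by
      by_contra hxS
      exact Finset.disjoint_left.1 h (Finset.mem_compl.2 hxS) hx

/-- Reversal of a finitely supported `PF₂` sequence is `PF₂`. [cite: Karlin1968, Ch. 8 §1] -/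
theorem isLogConcaveSeq_reverse {e : ℕ → ℝ} (he : IsLogConcaveSeq e) (N : ℕ) :
    IsLogConcaveSeq fun i => if i ≤ N then e (N - i) else 0 := by
  refine ⟨fun i => by dsimp only; split_ifs; exacts [he.1 _, le_rfl], ?_⟩
  intro a b c d hab hbd habcd
  dsimp only
  by_cases hd : d ≤ N
  · rw [if_pos (by omega), if_pos hd, if_pos (by omega), if_pos (by omega)]
    have := he.mul_le_mul (a := N - d) (b := N - c) (c := N - b) (d := N - a) (by omega) (by omega) (by omega)
    linarith [mul_comm (e (N - a)) (e (N - d)), mul_comm (e (N - b)) (e (N - c))]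
  · rw [if_neg hd, mul_zero]
    exact mul_nonneg (by split_ifs; exacts [he.1 _, le_rfl]) (by split_ifs; exacts [he.1 _, le_rfl])

/-- Shifts of `PF₂` sequences are `PF₂`. [cite: Karlin1968, Ch. 8 §1] -/
theorem isLogConcaveSeq_shift {f : ℕ → ℝ} (hf : IsLogConcaveSeq f) (N : ℕ) : IsLogConcaveSeq fun k => f (k + N) :=
  ⟨fun k => hf.1 _, fun _ _ _ _ hab hbd habcd => hf.mul_le_mul (by omega) (by omega) (by omega)⟩

/-- **`k ↦ Σ_j e_j q_{k+j}` is `PF₂`** for `PF₂` sequences `e` (supported in `[0,N]`) and `q` — a convolution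
with the reversal of `e` (BBL: "a convolution of two LC sequences, and hence is LC by [Kar]"; Pemantle's
Lemma 2.8). [cite: Pemantle2000, §2.4 Lemma 2.8; BorceaBrandenLiggett2007, §6 proof of Prop. 6.3; Karlin1968,
Ch. 8 §1] -/
theorem isLogConcaveSeq_corr {e q : ℕ → ℝ} (he : IsLogConcaveSeq e) (hq : IsLogConcaveSeq q) (N : ℕ) :
    IsLogConcaveSeq fun k => ∑ j ∈ range (N + 1), e j * q (k + j) := by
  have key : ∀ k, ∑ j ∈ range (N + 1), e j * q (k + j) =
      seqConv (fun i => if i ≤ N then e (N - i) else 0) q (k + N) := by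
    intro k
    rw [seqConv_def, ← Finset.sum_range_add_sum_Ico _ (show N + 1 ≤ k + N + 1 by omega),
      Finset.sum_eq_zero (s := Finset.Ico (N + 1) (k + N + 1)) fun i hi => by
        rw [Finset.mem_Ico] at hi; rw [if_neg (by omega), zero_mul], add_zero,
      ← Finset.sum_range_reflect _ (N + 1)]
    refine Finset.sum_congr rfl fun j hj => ?_
    rw [Finset.mem_range] at hj
    rw [if_pos (by omega), show N + 1 - 1 - j = N - j by omega, show k + (N - j) = k + N - j by omega]
  simp_rw [key]
  exact isLogConcaveSeq_shift (isLogConcaveSeq_seqConv (isLogConcaveSeq_reverse he N) hq) N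

omit [Fintype σ] in
/-- **The projected profile is `PF₂`** (`q'_k = Σ_{W ⊆ R} q_{k+|W|} a^W = Σ_j e_j(a|_R) q_{k+j}`).
[cite: Pemantle2000, §2.4 Lemma 2.8; BorceaBrandenLiggett2007, §6 Cor. 6.5 ((b): "`d_k` is just the `k`-th
elementary symmetric function")] -/
theorem isLogConcaveSeq_projProfile {q : ℕ → ℝ} (hq : IsLogConcaveSeq q) (R : Finset σ) {a : σ → ℝ}
    (ha : ∀ e, 0 ≤ a e) : IsLogConcaveSeq fun k => ∑ W ∈ R.powerset, q (k + W.card) * ∏ e ∈ W, a e := by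
  have key : ∀ k, ∑ W ∈ R.powerset, q (k + W.card) * ∏ e ∈ W, a e =
      ∑ j ∈ range (R.card + 1), (∑ W ∈ R.powersetCard j, ∏ e ∈ W, a e) * q (k + j) := by
    intro k
    rw [sum_powerset_eq_sum_powersetCard]
    refine Finset.sum_congr rfl fun j _ => ?_
    rw [Finset.sum_mul]
    exact Finset.sum_congr rfl fun W hW => by rw [(Finset.mem_powersetCard.1 hW).2, mul_comm]
  simp_rw [key]
  exact isLogConcaveSeq_corr (isLogConcaveSeq_esymmVal R fun i _ => ha i) hq R.card

end Projection

/-! ## §2 Weighted symmetrization (BBL Cor. 6.5 (a)) via Theorem 4.19 -/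

section WeightedSym

variable {σ : Type u} [Fintype σ] [DecidableEq σ]

omit [DecidableEq σ] in
/-- The constant weight `1` (product Bernoulli(½) up to normalization) is strongly Rayleigh:
`Σ_k C(n,k) t^k = (1+t)^n` has only real zeros (Thm. 3.8). [cite: BorceaBrandenLiggett2007, §3.5 Thm. 3.8; §3.1
(products of stable polynomials)] -/
theorem stableOrZero_const_one : StableOrZero (fun _ : Finset σ => (1 : ℝ)) := by
  have h := (stableOrZero_card_iff (σ := σ) (fun _ : ℕ => (1 : ℝ))).2
  refine h fun ζ hζ => ?_
  have hP : rankPoly (fun S : Finset σ => (fun _ : ℕ => (1 : ℝ)) S.card) = (Polynomial.X + 1) ^ Fintype.card σ := by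
    apply Polynomial.ext
    intro k
    rw [coeff_rankPoly, rankSeq_def, Finset.sum_const, Finset.card_powersetCard, Finset.card_univ, nsmul_eq_mul,
      mul_one, Polynomial.coeff_X_add_one_pow]
  rw [hP, Polynomial.map_pow, Polynomial.map_add, Polynomial.map_X, Polynomial.map_one, Polynomial.roots_pow,
    Multiset.mem_nsmul] at hζ
  obtain ⟨-, hζ⟩ := hζ
  rw [show (Polynomial.X + 1 : Polynomial ℂ) = Polynomial.X - Polynomial.C (-1) by
    rw [Polynomial.C_neg, Polynomial.C_1, sub_neg_eq_add], Polynomial.roots_X_sub_C, Multiset.mem_singleton] at hζ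
  rw [hζ]; simp

/-- The product weight `A ↦ 1_{A ⊆ P} w^A` as a conditioned external field of the constant weight, and its
value. [cite: BorceaBrandenLiggett2007, §6 proof of Cor. 6.5 (`c_k = Σ Π w_i^{X_i(S)}`)] -/
theorem prodW_apply (P : Finset σ) (w : σ → ℝ) (A : Finset σ) :
    pin ∅ Pᶜ (extField w fun _ : Finset σ => (1 : ℝ)) A = if A ⊆ P then ∏ e ∈ A, w e else 0 := by
  rw [pin_apply, extField_apply, one_mul]
  by_cases hA : A ⊆ P
  · rw [if_pos ⟨Finset.empty_subset _, Finset.disjoint_left.2 fun x hx hxA => (Finset.mem_compl.1 hx) (hA hxA)⟩,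
      if_pos hA]
  · rw [if_neg, if_neg hA]
    rintro ⟨-, h⟩
    exact hA fun x hx => by by_contra hxP; exact Finset.disjoint_left.1 h (Finset.mem_compl.2 hxP) hx

/-- The product weight is strongly Rayleigh. [cite: BorceaBrandenLiggett2007, §4.2 Thm. 4.9 ("closed under
conditioning and external fields"), §3.5 Thm. 3.8] -/
theorem stableOrZero_prodW (P : Finset σ) {w : σ → ℝ} (hw : ∀ e, 0 ≤ w e) :
    StableOrZero (pin ∅ Pᶜ (extField w fun _ : Finset σ => (1 : ℝ))) :=
  stableOrZero_pin (stableOrZero_extField stableOrZero_const_one hw) ∅ Pᶜ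

/-- Level sums of the product weight: `Σ_A 1_{|A|=i} μ_P(A) H(A) = Σ_{A ⊆ P, |A| = i} w^A H(A)`.
[cite: BorceaBrandenLiggett2007, §6 proof of Cor. 6.5] -/
theorem sum_truncW_prodW (P : Finset σ) (w : σ → ℝ) (i : ℕ) (H : Finset σ → ℝ) :
    ∑ A : Finset σ, truncW i i (pin ∅ Pᶜ (extField w fun _ : Finset σ => (1 : ℝ))) A * H A =
      ∑ A ∈ P.powersetCard i, (∏ e ∈ A, w e) * H A := by
  have hpc : P.powersetCard i = Finset.univ.filter fun A : Finset σ => i ≤ A.card ∧ A.card ≤ i ∧ A ⊆ P := by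
    ext A
    rw [Finset.mem_powersetCard, Finset.mem_filter]
    constructor
    · rintro ⟨h1, h2⟩; exact ⟨Finset.mem_univ _, h2.ge, h2.le, h1⟩
    · rintro ⟨-, h1, h2, h3⟩; exact ⟨h3, le_antisymm h2 h1⟩
  rw [hpc, Finset.sum_filter]
  refine Finset.sum_congr rfl fun A _ => ?_
  rw [truncW_apply, prodW_apply]
  by_cases h1 : i ≤ A.card ∧ A.card ≤ i
  · by_cases h2 : A ⊆ P
    · rw [if_pos h1, if_pos h2, if_pos ⟨h1.1, h1.2, h2⟩]
    · rw [if_pos h1, if_neg h2, zero_mul, if_neg (fun h => h2 h.2.2)]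
  · rw [if_neg h1, zero_mul, if_neg (fun h => h1 ⟨h.1, h.2.1⟩)]

/-- **BBL Cor. 6.5 (a): the weighted symmetrized averages `f_i = c_i^{-1} Σ_{|A|=i} w^A F(A)` increase in `i`**
(`w > 0` on `P`, `F` increasing) — here from Theorem 4.19 for the strongly Rayleigh product weight.
[cite: BorceaBrandenLiggett2007, §6 proof of Cor. 6.5 ((a) `f_k ≤ f_{k+1}`); §4.3.2 Thm. 4.19] -/
theorem wAvg_mono (P : Finset σ) {w : σ → ℝ} (hw0 : ∀ e, 0 ≤ w e) (hw : ∀ e ∈ P, 0 < w e)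
    {Φ : Finset σ → ℝ} (hΦ : Monotone Φ) :
    ∀ i i', i ≤ i' → i' ≤ P.card →
      (∑ A ∈ P.powersetCard i, (∏ e ∈ A, w e) * Φ A) / (∑ A ∈ P.powersetCard i, ∏ e ∈ A, w e) ≤
        (∑ A ∈ P.powersetCard i', (∏ e ∈ A, w e) * Φ A) / (∑ A ∈ P.powersetCard i', ∏ e ∈ A, w e) := by
  set μP := pin ∅ Pᶜ (extField w fun _ : Finset σ => (1 : ℝ)) with hμP
  have hμP0 : ∀ A, 0 ≤ μP A := pin_nonneg (extField_nonneg (fun _ => zero_le_one) hw0) ∅ Pᶜ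
  have hmass : ∀ i, mass (truncW i i μP) = ∑ A ∈ P.powersetCard i, ∏ e ∈ A, w e := fun i => by
    have := sum_truncW_prodW P w i (fun _ => 1)
    simp only [mul_one] at this
    rw [mass_def, this]
  have hex : ∀ i, ex (truncMeasure i i μP) Φ =
      (∑ A ∈ P.powersetCard i, (∏ e ∈ A, w e) * Φ A) / (∑ A ∈ P.powersetCard i, ∏ e ∈ A, w e) := fun i => by
    rw [ex_def, ← hmass, ← sum_truncW_prodW P w i Φ, Finset.sum_div]
    exact Finset.sum_congr rfl fun A _ => by rw [truncMeasure_apply]; ring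
  have hpos : ∀ i, i ≤ P.card → mass (truncW i i μP) ≠ 0 := fun i hi => by
    rw [hmass]
    obtain ⟨A, hA⟩ : (P.powersetCard i).Nonempty := Finset.powersetCard_nonempty.2 hi
    exact (lt_of_lt_of_le (Finset.prod_pos fun e he => hw e ((Finset.mem_powersetCard.1 hA).1 he))
      (Finset.single_le_sum (f := fun A => ∏ e ∈ A, w e)
        (fun B hB => Finset.prod_nonneg fun e _ => hw0 e) hA)).ne'
  refine mono_of_succ_le fun i hi => ?_
  rw [← hex, ← hex]
  have := (stableOrZero_prodW P hw0).ex_truncMeasure_le hμP0 (k := i + 1) (by omega)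
    (by rw [Nat.add_sub_cancel]; exact hpos i (by omega)) (hpos (i + 1) hi) hΦ
  rwa [Nat.add_sub_cancel] at this

end WeightedSym

/-! ## §3 NA of conditioned external fields of exchangeable `PF₂` weights -/

section MainW

variable {σ : Type u} [Fintype σ] [DecidableEq σ]

/-- **`pin I O ((S ↦ q_{|S|})^w)` is negatively associated** for a `PF₂` profile `q` and a field `w ≥ 0` positive
off `O` (BBL Cor. 6.5's weighted symmetrization in the exchangeable case: `f_i = c_i^{-1} Σ_{|A|=i} w^A F(A)`
increase by §2, the kernel `p_{ij} = c_i d_j q_{c+i+j}` is `RR₂` by log-concavity, and the `RR₂` rearrangement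
gives `E[FG] Z ≤ E[F] E[G]`). [cite: BorceaBrandenLiggett2007, §6 Cor. 6.5 (proof), Thm. 6.4 (proof);
Pemantle2000, §2.4 Thm. 2.7] -/
theorem isNegAssoc_pin_extField_card {q : ℕ → ℝ} (hq : IsLogConcaveSeq q) {w : σ → ℝ} (hw0 : ∀ e, 0 ≤ w e)
    (I O : Finset σ) (hw : ∀ e, e ∉ O → 0 < w e) :
    IsNegAssoc (pin I O (extField w fun S : Finset σ => q S.card)) := by
  intro F G hF hG E₁ E₂ hFE hGE hdisj
  set ν := pin I O (extField w fun S : Finset σ => q S.card) with hν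
  by_cases hIO : Disjoint I O
  swap
  · have hz : ∀ S, ν S = 0 := fun S => by
      rw [hν, pin_apply, if_neg]
      rintro ⟨hIS, hOS⟩
      exact hIO (hOS.symm.mono_left hIS)
    have hex : ∀ H : Finset σ → ℝ, ex ν H = 0 := fun H => Finset.sum_eq_zero fun S _ => by rw [hz S, zero_mul]
    rw [hex, hex, hex, zero_mul, zero_mul]
  -- the free coordinates, split along `E₁`
  set P : Finset σ := (I ∪ O)ᶜ ∩ E₁ with hP
  set Q : Finset σ := (I ∪ O)ᶜ \ E₁ with hQ
  have hPQ : Disjoint P Q := Finset.disjoint_left.2 fun x hxP hxQ =>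
    (Finset.mem_sdiff.1 hxQ).2 (Finset.mem_inter.1 hxP).2
  have hR : P ∪ Q = (I ∪ O)ᶜ := by
    ext x; simp only [hP, hQ, Finset.mem_union, Finset.mem_inter, Finset.mem_sdiff]; tauto
  have hwP : ∀ e ∈ P, 0 < w e := fun e he =>
    hw e fun heO => (Finset.mem_compl.1 (Finset.mem_inter.1 he).1) (Finset.mem_union_right _ heO)
  have hwQ : ∀ e ∈ Q, 0 < w e := fun e he =>
    hw e fun heO => (Finset.mem_compl.1 (Finset.mem_sdiff.1 he).1) (Finset.mem_union_right _ heO)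
  set m := P.card with hm
  set m' := Q.card with hm'
  set c := I.card with hc
  set wI : ℝ := ∏ e ∈ I, w e with hwIdef
  have hwI : 0 ≤ wI := Finset.prod_nonneg fun e _ => hw0 e
  -- the symmetrized test functions
  set Φ : Finset σ → ℝ := fun A => F (I ∪ A) with hΦ
  set Ψ : Finset σ → ℝ := fun B => G (I ∪ B) with hΨ
  have hΦmono : Monotone Φ := fun A B hAB => hF (Finset.union_subset_union (subset_refl I) hAB)
  have hΨmono : Monotone Ψ := fun A B hAB => hG (Finset.union_subset_union (subset_refl I) hAB)
  have hFval : ∀ A ∈ P.powerset, ∀ B ∈ Q.powerset, F (I ∪ (A ∪ B)) = Φ A := fun A hA B hB => by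
    rw [Finset.mem_powerset] at hA hB
    refine hFE _ _ ?_
    rw [← Finset.union_assoc, Finset.union_inter_distrib_right (I ∪ A) B E₁]
    have : B ∩ E₁ = ∅ := Finset.eq_empty_of_forall_notMem fun x hx =>
      (Finset.mem_sdiff.1 (hB (Finset.mem_inter.1 hx).1)).2 (Finset.mem_inter.1 hx).2
    rw [this, Finset.union_empty]
  have hGval : ∀ A ∈ P.powerset, ∀ B ∈ Q.powerset, G (I ∪ (A ∪ B)) = Ψ B := fun A hA B hB => by
    rw [Finset.mem_powerset] at hA hB
    refine hGE _ _ ?_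
    have : A ∩ E₂ = ∅ := Finset.eq_empty_of_forall_notMem fun x hx =>
      Finset.disjoint_left.1 hdisj (Finset.mem_inter.1 (hA (Finset.mem_inter.1 hx).1)).2 (Finset.mem_inter.1 hx).2
    rw [Finset.union_inter_distrib_right, Finset.union_inter_distrib_right, this, Finset.empty_union,
      ← Finset.union_inter_distrib_right]
  -- the field splits over `I`, `A`, `B`
  have hWval : ∀ A ∈ P.powerset, ∀ B ∈ Q.powerset,
      ∏ e ∈ I ∪ (A ∪ B), w e = wI * ((∏ e ∈ A, w e) * ∏ e ∈ B, w e) := fun A hA B hB => by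
    rw [Finset.mem_powerset] at hA hB
    have hAB : A ∪ B ⊆ (I ∪ O)ᶜ := by rw [← hR]; exact Finset.union_subset_union hA hB
    have hIAB : Disjoint I (A ∪ B) := Finset.disjoint_left.2 fun x hxI hx =>
      (Finset.mem_compl.1 (hAB hx)) (Finset.mem_union_left _ hxI)
    rw [Finset.prod_union hIAB, Finset.prod_union (hPQ.mono hA hB)]
  -- expectations under `ν` are expectations under the unweighted conditioned weight of `w^S H(S)`
  have exW : ∀ H : Finset σ → ℝ,
      ex ν H = ex (pin I O fun S : Finset σ => q S.card) (fun S => (∏ e ∈ S, w e) * H S) := fun H => by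
    rw [ex_def, ex_def]
    refine Finset.sum_congr rfl fun S _ => ?_
    rw [hν, pin_extField, extField_apply]
    ring
  -- the weighted symmetrized sums
  set SΦ : ℕ → ℝ := fun i => ∑ A ∈ P.powersetCard i, (∏ e ∈ A, w e) * Φ A with hSΦ
  set SΨ : ℕ → ℝ := fun j => ∑ B ∈ Q.powersetCard j, (∏ e ∈ B, w e) * Ψ B with hSΨ
  set cP : ℕ → ℝ := fun i => ∑ A ∈ P.powersetCard i, ∏ e ∈ A, w e with hcP
  set dQ : ℕ → ℝ := fun j => ∑ B ∈ Q.powersetCard j, ∏ e ∈ B, w e with hdQ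
  have pcP : ∀ {i} {A}, A ∈ P.powersetCard i → A ∈ P.powerset := fun h =>
    Finset.mem_powerset.2 (Finset.mem_powersetCard.1 h).1
  have pcQ : ∀ {j} {B}, B ∈ Q.powersetCard j → B ∈ Q.powerset := fun h =>
    Finset.mem_powerset.2 (Finset.mem_powersetCard.1 h).1
  -- the four expectations
  have eFG : ex ν (F * G) = ∑ i ∈ range (m + 1), ∑ j ∈ range (m' + 1), q (c + i + j) * (wI * (SΦ i * SΨ j)) := by
    rw [exW, ex_pin_card_split hIO hPQ hR]
    refine Finset.sum_congr rfl fun i _ => Finset.sum_congr rfl fun j _ => ?_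
    congr 1
    rw [hSΦ, hSΨ, Finset.sum_mul_sum, Finset.mul_sum]
    refine Finset.sum_congr rfl fun A hA => ?_
    rw [Finset.mul_sum]
    refine Finset.sum_congr rfl fun B hB => ?_
    rw [Pi.mul_apply, hFval A (pcP hA) B (pcQ hB), hGval A (pcP hA) B (pcQ hB), hWval A (pcP hA) B (pcQ hB)]
    ring
  have eF : ex ν F = ∑ i ∈ range (m + 1), ∑ j ∈ range (m' + 1), q (c + i + j) * (wI * (SΦ i * dQ j)) := by
    rw [exW, ex_pin_card_split hIO hPQ hR]
    refine Finset.sum_congr rfl fun i _ => Finset.sum_congr rfl fun j _ => ?_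
    congr 1
    rw [hSΦ, hdQ, Finset.sum_mul_sum, Finset.mul_sum]
    refine Finset.sum_congr rfl fun A hA => ?_
    rw [Finset.mul_sum]
    refine Finset.sum_congr rfl fun B hB => ?_
    rw [hFval A (pcP hA) B (pcQ hB), hWval A (pcP hA) B (pcQ hB)]
    ring
  have eG : ex ν G = ∑ i ∈ range (m + 1), ∑ j ∈ range (m' + 1), q (c + i + j) * (wI * (cP i * SΨ j)) := by
    rw [exW, ex_pin_card_split hIO hPQ hR]
    refine Finset.sum_congr rfl fun i _ => Finset.sum_congr rfl fun j _ => ?_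
    congr 1
    rw [hcP, hSΨ, Finset.sum_mul_sum, Finset.mul_sum]
    refine Finset.sum_congr rfl fun A hA => ?_
    rw [Finset.mul_sum]
    refine Finset.sum_congr rfl fun B hB => ?_
    rw [hGval A (pcP hA) B (pcQ hB), hWval A (pcP hA) B (pcQ hB)]
    ring
  have e1 : mass ν = ∑ i ∈ range (m + 1), ∑ j ∈ range (m' + 1), q (c + i + j) * (wI * (cP i * dQ j)) := by
    rw [show mass ν = ex ν (fun _ => 1) by simp [mass_def, ex_def], exW, ex_pin_card_split hIO hPQ hR]
    refine Finset.sum_congr rfl fun i _ => Finset.sum_congr rfl fun j _ => ?_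
    congr 1
    rw [hcP, hdQ, Finset.sum_mul_sum, Finset.mul_sum]
    refine Finset.sum_congr rfl fun A hA => ?_
    rw [Finset.mul_sum]
    refine Finset.sum_congr rfl fun B hB => ?_
    rw [hWval A (pcP hA) B (pcQ hB)]
    ring
  -- the kernel and the averages
  set p : ℕ → ℕ → ℝ := fun i j => q (c + i + j) * (cP i * dQ j) with hp
  set f : ℕ → ℝ := fun i => SΦ i / cP i with hf
  set g : ℕ → ℝ := fun j => SΨ j / dQ j with hg
  have hpos : ∀ (R : Finset σ), (∀ e ∈ R, 0 < w e) → ∀ i ∈ range (R.card + 1),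
      (∑ A ∈ R.powersetCard i, ∏ e ∈ A, w e) ≠ 0 := fun R hwR i hi => by
    rw [Finset.mem_range] at hi
    obtain ⟨A, hA⟩ : (R.powersetCard i).Nonempty := Finset.powersetCard_nonempty.2 (by omega)
    exact (lt_of_lt_of_le (Finset.prod_pos fun e he => hwR e ((Finset.mem_powersetCard.1 hA).1 he))
      (Finset.single_le_sum (f := fun A => ∏ e ∈ A, w e)
        (fun B _ => Finset.prod_nonneg fun e _ => hw0 e) hA)).ne'
  have hCi : ∀ i ∈ range (m + 1), cP i ≠ 0 := hpos P hwP
  have hCj : ∀ j ∈ range (m' + 1), dQ j ≠ 0 := hpos Q hwQ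
  have pull : ∀ X : ℕ → ℕ → ℝ, ∑ i ∈ range (m + 1), ∑ j ∈ range (m' + 1), q (c + i + j) * (wI * X i j) =
      wI * ∑ i ∈ range (m + 1), ∑ j ∈ range (m' + 1), q (c + i + j) * X i j := fun X => by
    rw [Finset.mul_sum]
    refine Finset.sum_congr rfl fun i _ => ?_
    rw [Finset.mul_sum]
    exact Finset.sum_congr rfl fun j _ => by ring
  have rFG : ex ν (F * G) = wI * ∑ i ∈ range (m + 1), ∑ j ∈ range (m' + 1), p i j * (f i * g j) := by
    rw [eFG, pull]
    congr 1
    refine Finset.sum_congr rfl fun i hi => Finset.sum_congr rfl fun j hj => ?_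
    simp only [hp, hf, hg]
    field_simp [hCi i hi, hCj j hj]
  have rF : ex ν F = wI * ∑ i ∈ range (m + 1), ∑ j ∈ range (m' + 1), p i j * f i := by
    rw [eF, pull]
    congr 1
    refine Finset.sum_congr rfl fun i hi => Finset.sum_congr rfl fun j hj => ?_
    simp only [hp, hf]
    field_simp [hCi i hi]
  have rG : ex ν G = wI * ∑ i ∈ range (m + 1), ∑ j ∈ range (m' + 1), p i j * g j := by
    rw [eG, pull]
    congr 1
    refine Finset.sum_congr rfl fun i hi => Finset.sum_congr rfl fun j hj => ?_
    simp only [hp, hg]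
    field_simp [hCj j hj]
  have r1 : mass ν = wI * ∑ i ∈ range (m + 1), ∑ j ∈ range (m' + 1), p i j := by rw [e1, pull]
  rw [rFG, r1, rF, rG]
  have key := rr2_sum_mul_sum_le m m' p f g (fun i i' j j' hii' hjj' => ?_)
    (wAvg_mono P hw0 hwP hΦmono) (wAvg_mono Q hw0 hwQ hΨmono)
  · calc wI * (∑ i ∈ range (m + 1), ∑ j ∈ range (m' + 1), p i j * (f i * g j)) *
          (wI * ∑ i ∈ range (m + 1), ∑ j ∈ range (m' + 1), p i j)
        = (wI * wI) * ((∑ i ∈ range (m + 1), ∑ j ∈ range (m' + 1), p i j * (f i * g j)) *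
            ∑ i ∈ range (m + 1), ∑ j ∈ range (m' + 1), p i j) := by ring
      _ ≤ (wI * wI) * ((∑ i ∈ range (m + 1), ∑ j ∈ range (m' + 1), p i j * f i) *
            ∑ i ∈ range (m + 1), ∑ j ∈ range (m' + 1), p i j * g j) :=
          mul_le_mul_of_nonneg_left key (mul_nonneg hwI hwI)
      _ = wI * (∑ i ∈ range (m + 1), ∑ j ∈ range (m' + 1), p i j * f i) *
            (wI * ∑ i ∈ range (m + 1), ∑ j ∈ range (m' + 1), p i j * g j) := by ring
  -- `RR₂` of the kernel
  have hqq : q (c + i + j) * q (c + i' + j') ≤ q (c + i + j') * q (c + i' + j) :=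
    hq.mul_le_mul (by omega) (by omega) (by omega)
  have hcP0 : ∀ i, 0 ≤ cP i := fun i => Finset.sum_nonneg fun A _ => Finset.prod_nonneg fun e _ => hw0 e
  have hdQ0 : ∀ j, 0 ≤ dQ j := fun j => Finset.sum_nonneg fun B _ => Finset.prod_nonneg fun e _ => hw0 e
  have hB : 0 ≤ (cP i * dQ j) * (cP i' * dQ j') := by
    have := hcP0 i; have := hcP0 i'; have := hdQ0 j; have := hdQ0 j'; positivity
  calc p i j * p i' j'
      = (q (c + i + j) * q (c + i' + j')) * ((cP i * dQ j) * (cP i' * dQ j')) := by simp only [hp]; ring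
    _ ≤ (q (c + i + j') * q (c + i' + j)) * ((cP i * dQ j) * (cP i' * dQ j')) := mul_le_mul_of_nonneg_right hqq hB
    _ = p i j' * p i' j := by simp only [hp]; ring

end MainW

/-! ## §4 CNA+ (Pemantle Thm. 2.7, BBL Thm. 3.7) -/

section CNAPlus

variable {σ : Type u} [Fintype σ] [DecidableEq σ]

/-- **Exchangeable weights with a `PF₂` profile are CNA+.** [cite: Pemantle2000, §2.4 Thm. 2.7 (ULC ⟹ CNA+);
BorceaBrandenLiggett2007, §3 Thm. 3.7 ((1) ⟹ CNA+)] -/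
theorem isCNAPlus_card {q : ℕ → ℝ} (hq : IsLogConcaveSeq q) : IsCNAPlus (fun S : Finset σ => q S.card) := by
  intro a ha S I O
  -- one external field, one projection: an external field of a conditioned exchangeable `PF₂` weight
  rw [projectOn_extField_card_eq, pin_extField, pin_pin, Finset.union_empty, extField_eq_pin_zeroSet,
    ← pin_extField, pin_pin, Finset.empty_union]
  refine isNegAssoc_pin_extField_card (isLogConcaveSeq_projProfile hq Sᶜ ha) ha I _ fun e he => ?_
  rw [Finset.mem_union, not_or, Finset.mem_filter] at he
  exact lt_of_le_of_ne (ha e) fun h => he.1 ⟨Finset.mem_univ e, h.symm⟩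

/-- **Borcea–Brändén–Liggett, Theorem 3.7 ([P]) — the CNA+ arrow as an equivalence**: for a nonnegative
exchangeable weight, Rayleigh/h-NLC+ ⟺ CNA+ (with `ExchangeableRayleigh.lean`: ⟺ NLC ⟺ h-NLC ⟺ ULC rank
sequence). [cite: BorceaBrandenLiggett2007, §3 Thm. 3.7; Pemantle2000, §2.4 Thm. 2.7] -/
theorem BorceaBrandenLiggett_thm_3_7 {μ : Finset σ → ℝ} (hex : IsExchangeable μ) (h0 : ∀ S, 0 ≤ μ S) :
    IsRayleigh μ ↔ IsCNAPlus μ := by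
  refine ⟨fun h => ?_, fun h => h.isRayleigh⟩
  obtain ⟨q, hq, hμ⟩ := (hex.isRayleigh_iff h0).1 h
  rw [show μ = fun S => q S.card from funext hμ]
  exact isCNAPlus_card hq

/-- **Pemantle, Theorem 2.7 (exchangeable measures): CNA+ ⟺ h-NLC+ ⟺ h-NLC ⟺ NLC ⟺ ULC rank sequence
(`PF₂` profile), each implying CNA.** [cite: Pemantle2000, §2.4 Thm. 2.7; BorceaBrandenLiggett2007, §3 Thm. 3.7] -/
theorem Pemantle2000_thm_2_7 {μ : Finset σ → ℝ} (hex : IsExchangeable μ) (h0 : ∀ S, 0 ≤ μ S) :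
    (IsCNAPlus μ ↔ ∃ q : ℕ → ℝ, IsLogConcaveSeq q ∧ ∀ S, μ S = q S.card) ∧
      (IsHNLCPlus μ ↔ ∃ q : ℕ → ℝ, IsLogConcaveSeq q ∧ ∀ S, μ S = q S.card) ∧
      (IsHNLC μ ↔ ∃ q : ℕ → ℝ, IsLogConcaveSeq q ∧ ∀ S, μ S = q S.card) ∧
      (IsNLC μ ↔ ∃ q : ℕ → ℝ, IsLogConcaveSeq q ∧ ∀ S, μ S = q S.card) ∧
      (IsCNAPlus μ → IsCNA μ) := by
  refine ⟨?_, hex.isHNLCPlus_iff h0, hex.isHNLC_iff h0, hex.isNLC_iff h0, fun h => h.isCNA⟩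
  rw [← BorceaBrandenLiggett_thm_3_7 hex h0]
  exact hex.isRayleigh_iff h0

end CNAPlus

end Literature.Probability.NegativeDependence

end
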